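import Summits.QuantumFields.YangMills.Theorems.AllWindowsColdBoxBoxHighLineRestrictionSetCrossParityReduce
import Summits.QuantumFields.YangMills.Theorems.AllWindowsColdBoxBoxHighLineRestrictionSetCum3Slots
import Summits.QuantumFields.YangMills.Theorems.AllWindowsColdBoxBoxHighLineEdgeChartHyper
import Summits.QuantumFields.YangMills.Theorems.AllWindowsColdBoxBoxHighLineTiltSupBoundsWilson
import Summits.QuantumFields.YangMills.Theorems.AllWindowsColdBoxBoxHighLinePlaqCostSizesOnD
import Summits.QuantumFields.YangMills.Theorems.AllWindowsColdBoxBoxHighLineGaussCovMainReduction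
import Summits.QuantumFields.YangMills.Theorems.AllWindowsColdBoxBoxHighLineAssemblyEpsTwoBudget

/-!
# U5 K3′ — row (γ): the SEXTIC WILSON REMAINDER slot `κ₃,₀^{μ_D}(L_x, L_y; −β·Σ_p Rem₆,p)`, GENERIC in the quartic form, and the
# generic «sup × L²» row for `κ₃` (planner ym-idea-2 g19 RULING 2026-08-30T01:41:11Z «(γ) → w4 g30, typed generically»; K3′ term table of record =
# fcl-p3 g27's Q8 answer / ✓`abs_tiltCum3_muSet_zero_le_rows` row RA; LINE-20 U5 ⟨stmt-QuantumFields-24336⟩ — U5 prep, helper-grade)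

Extra width seat `ym-line-sfw-p2-w4` (g30).  In fcl-p3 g27's row decomposition ✓`GaussRestrict.abs_tiltCum3_muSet_zero_le_rows` of `f′(0) = −κ₃,₀` on the cut
set, the even remainder `Re := Uᵉ − Ve` of the tilt (everything even in `tiltU` beyond the polynomial vertex `Ve`) enters only through the row
`RA = κ₃(L_x, L_y; Re)`, and `Re` is a SUM of remainders (Wilson sextic, ghost-even beyond `quadVal`, Haar beyond Haar₂, Φ-sextic), each small in SUP on
the small-field set.  This file supplies

* ★ `GaussRestrict.abs_tiltCum3_muSet_zero_le_sup_mul_sd` — the GENERIC «sup × L²» row for `κ₃` over `μ_D`: for `E₀[1 − 1_D] ≤ τ ≤ 1/2`, `X Y N`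
  measurable, `X Y` bounded on `D`, `sup_D |N| ≤ ν`, and ANY centrings `a₁ a₂`:
  `|κ₃,₀^{μ_D}(X, Y; N)| ≤ 2ν·√(2E₀[1_D(X−a₁)²])·√(2E₀[1_D(Y−a₂)²])`
  (Cauchy–Schwarz ✓`abs_tiltExp_muSet_zero_pair_le`, ✓`tiltExp_muSet_zero_mono_on`, ✓`tiltExp_muSet_zero_centredSq_le`, ✓`tiltExp_muSet_zero_le_two_mul_gaussAvg`)
  — the abstract lemma EVERY RA-type remainder row uses (this seat: Wilson sextic; w5 g24: ghost-even 7d⁽⁴⁾; fcl-p3 g27: Haar / Φ-sextic);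
* ★ `GaussRestrict.abs_tiltCum3_muSet_linCurvSq_linCurvSq_le_of_sup` — its instance at the two linearised plaquette slots `L_z = linCurvSq H (plaq12At z)`
  centred at their Gaussian means: `≤ 4·C_V·ν·(1+log H)²/β²` (✓`EdgeChartGaussian.gaussAvg_centred_linCurvSq_sq_le` through `D ⊆` everything);
* ★★ `GaussRestrict.abs_tiltCum3_muSet_wilsonSexticRow_le` — THE (γ) ROW, generic in the quartic form: for ANY family `Q : ZdPlaquette 4 → (field → ℝ)` of
  measurable plaquette functionals with `|c_p − |ℓ_p|² − c_p^{odd} − Q p| ≤ C_R·s⁶` on `smallField H s` for the plaquettes touching the box (= w3 g42's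
  7a⁽⁴⁾ `WilsonPlaquetteQuarticForm` conclusion at `t := s`), the tilt slot `N_W := −β·Σ_p (c_p − |ℓ_p|² − c_p^{odd} − Q p)` (= «`−quarticWilson` minus its
  `Q`-polynomial part») has `sup_D |N_W| ≤ 4096·C_R·β·H⁴·s⁶` and
  `|κ₃,₀^{μ_D}(L_x, L_y; N_W)| ≤ 16384·C_V·C_R·H⁴·(1+log H)²·s⁶/β`;
* ★ `GaussRestrict.wilsonSexticRow_budget` — the β-letter budget of that size at the point of record (`s = β^{(1/8−θ/4)−1/2}`):
  `β²H⁸·(C·H⁴(1+log H)²s⁶/β) ≤ ε` eventually on the top slab, row (K7) **`21θ/2 − 5/4 < 0 ⟺ θ < 5/42`** ✓ for every `θ < 1/10` (✓`budget_monomial`).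

Parity note: the ODD quintic Wilson remainder `c^{odd} − tripleForm` lives in `N = Uᵒ − P` (row RC) and its `(L_x, L_y)`-slot is `≡ 0` on a symmetric `D` by
fcl-p3's ✓`tiltCum3_muSet_zero_eq_zero_of_even_even_odd`; nothing is added for it here.

No definitions; tree only; standard axioms.  HONEST LABEL: helper-grade glue for ONE remainder row of the open size hypothesis `hK3` of the CONDITIONAL U5
bookkeeping ✓`landauThirdOrder_of_sizes₂`; `hK3`, U5 `stub_landauThirdOrder`, ⟨24336⟩, ⟨24004⟩ and this seat's crux ⟨stmt-QuantumFields-22884⟩ remain OPEN; route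
AllWindowsColdBox is DRAFT; no crux, rung or summit is proved; **the Yang–Mills mass gap is NOT proved by this file; no summit is proved by a line.**
-/

set_option autoImplicit false

noncomputable section

open MeasureTheory Set
open Literature.Probability.LatticeModels (Site)
open Literature.MathematicalPhysics.QuantumLattice (ZdPlaquette plaquettesTouching)
open Literature.MathematicalPhysics.QuantumFieldTheory.AxialGauge (boxEdges)
open Summit.QuantumFields.YangMills.Theorems.WeakCouplingRates (plaq12At)

namespace Summit.QuantumFields.YangMills.Theorems.AllWindowsColdBoxBoxHighLine

namespace GaussRestrict

variable {H : ℕ} {β : ℝ}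

/-! ## §1 The generic «sup × L²» row for `κ₃` over `μ_D` -/

/-- ★ **«sup × L²» bound on `κ₃,₀` over `μ_D`**: `E₀[1 − 1_D] ≤ τ ≤ 1/2`; `X Y N` measurable, `X Y` bounded by `B` on `D`, `|N| ≤ ν` on `D`; then for ANY
constants `a₁ a₂`: `|κ₃,₀^{μ_D}(X,Y;N)| ≤ 2ν·√(2E₀[1_D(X−a₁)²])·√(2E₀[1_D(Y−a₂)²])`. -/
theorem abs_tiltCum3_muSet_zero_le_sup_mul_sd (hβ : 0 < β) {D : Set (LandauFree H → E3)} (hDm : MeasurableSet D) {τ : ℝ}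
    (hτ : gaussAvg β H (fun a => 1 - D.indicator (fun _ => (1 : ℝ)) a) ≤ τ) (hτ2 : τ ≤ 1 / 2)
    {X Y N : (LandauFree H → E3) → ℝ} {B ν : ℝ} (hB : 0 ≤ B) (hν : 0 ≤ ν) (mX : Measurable X) (mY : Measurable Y) (mN : Measurable N)
    (bX : ∀ a ∈ D, |X a| ≤ B) (bY : ∀ a ∈ D, |Y a| ≤ B) (bN : ∀ a ∈ D, |N a| ≤ ν) (a₁ a₂ : ℝ) :
    |Tilt.tiltCum3 ((((volume : Measure (LandauFree H → E3)).restrict D).withDensity fun a => ENNReal.ofReal (gaussWeight β H a))) N 0 X Y| ≤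
      2 * ν * (Real.sqrt (2 * gaussAvg β H (fun a => D.indicator (fun _ => (1 : ℝ)) a * (X a - a₁) ^ 2)) *
        Real.sqrt (2 * gaussAvg β H (fun a => D.indicator (fun _ => (1 : ℝ)) a * (Y a - a₂) ^ 2))) := by
  have hD := integral_indicator_mul_gaussWeight_pos hβ hDm hτ hτ2
  set μD : Measure (LandauFree H → E3) := (((volume : Measure (LandauFree H → E3)).restrict D).withDensity fun a => ENNReal.ofReal (gaussWeight β H a))
    with hμD
  set mXc := Tilt.tiltExp μD N 0 X with hmXc
  set mYc := Tilt.tiltExp μD N 0 Y with hmYc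
  set mNc := Tilt.tiltExp μD N 0 N with hmNc
  have bmX : |mXc| ≤ B := abs_tiltExp_muSet_zero_le hβ hDm hD N hB bX
  have bmY : |mYc| ≤ B := abs_tiltExp_muSet_zero_le hβ hDm hD N hB bY
  have bmN : |mNc| ≤ ν := abs_tiltExp_muSet_zero_le hβ hDm hD N hν bN
  have cX : ∀ a ∈ D, |X a - mXc| ≤ 2 * B := fun a ha => (abs_sub _ _).trans (by linarith [bX a ha])
  have cY : ∀ a ∈ D, |Y a - mYc| ≤ 2 * B := fun a ha => (abs_sub _ _).trans (by linarith [bY a ha])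
  have cN : ∀ a ∈ D, |N a - mNc| ≤ 2 * ν := fun a ha => (abs_sub _ _).trans (by linarith [bN a ha])
  have mcX : Measurable fun a => X a - mXc := mX.sub measurable_const
  have mcY : Measurable fun a => Y a - mYc := mY.sub measurable_const
  have mcN : Measurable fun a => N a - mNc := mN.sub measurable_const
  -- `κ₃ = E[X̃·(ỸÑ)]`
  have hκ : Tilt.tiltCum3 μD N 0 X Y = Tilt.tiltExp μD N 0 (fun a => (X a - mXc) * ((Y a - mYc) * (N a - mNc))) := by
    unfold Tilt.tiltCum3
    exact congrArg _ (funext fun a => mul_assoc _ _ _)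
  rw [hκ]
  -- one common bound for the Cauchy–Schwarz / monotonicity lemmas
  set Bc : ℝ := 2 * B + 2 * B * (2 * ν) + (2 * B) ^ 2 * (2 * ν) ^ 2 + (2 * ν) ^ 2 * (2 * B) ^ 2 with hBc
  have h2B : 0 ≤ 2 * B := by linarith
  have h2ν : 0 ≤ 2 * ν := by linarith
  have hBc0 : 0 ≤ Bc := by positivity
  have bF : ∀ a ∈ D, |X a - mXc| ≤ Bc := fun a ha => (cX a ha).trans (by rw [hBc]; nlinarith [h2B, h2ν])
  have bG : ∀ a ∈ D, |(Y a - mYc) * (N a - mNc)| ≤ Bc := fun a ha => by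
    rw [abs_mul]
    have := mul_le_mul (cY a ha) (cN a ha) (abs_nonneg _) h2B
    rw [hBc]; nlinarith [h2B, h2ν, this]
  have mYN : Measurable fun a => (Y a - mYc) * (N a - mNc) := mcY.mul mcN
  have hCS := abs_tiltExp_muSet_zero_pair_le (β := β) hDm N hBc0 mcX mYN bF bG
  -- `E[(ỸÑ)²] ≤ (2ν)²·E[Ỹ²]`
  have mG2 : Measurable fun a => ((Y a - mYc) * (N a - mNc)) ^ 2 := (mcY.mul mcN).pow_const 2
  have mY2 : Measurable fun a => (2 * ν) ^ 2 * (Y a - mYc) ^ 2 := (mcY.pow_const 2).const_mul _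
  have bG2 : ∀ a ∈ D, |((Y a - mYc) * (N a - mNc)) ^ 2| ≤ Bc := fun a ha => by
    rw [abs_pow, abs_mul, mul_pow]
    have h1 := pow_le_pow_left₀ (abs_nonneg _) (cY a ha) 2
    have h2 := pow_le_pow_left₀ (abs_nonneg _) (cN a ha) 2
    have := mul_le_mul h1 h2 (by positivity) (by positivity)
    rw [hBc]; nlinarith [h2B, h2ν, this]
  have bY2 : ∀ a ∈ D, |(2 * ν) ^ 2 * (Y a - mYc) ^ 2| ≤ Bc := fun a ha => by
    rw [abs_mul, abs_pow, abs_pow, abs_of_nonneg h2ν]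
    have h1 := pow_le_pow_left₀ (abs_nonneg _) (cY a ha) 2
    have := mul_le_mul_of_nonneg_left h1 (pow_nonneg h2ν 2)
    rw [hBc]; nlinarith [h2B, h2ν, this]
  have hdom : ∀ a ∈ D, ((Y a - mYc) * (N a - mNc)) ^ 2 ≤ (2 * ν) ^ 2 * (Y a - mYc) ^ 2 := fun a ha => by
    rw [mul_pow, mul_comm]
    exact mul_le_mul_of_nonneg_right (by
      have h := cN a ha
      rw [← sq_abs]; exact pow_le_pow_left₀ (abs_nonneg _) h 2) (sq_nonneg _)
  have hmono := tiltExp_muSet_zero_mono_on hβ hDm hD N hBc0 mG2 mY2 bG2 bY2 hdom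
  rw [tiltExp_muSet_zero_const_mul] at hmono
  -- `E[X̃²] ≤ E[(X−a₁)²] ≤ 2E₀[1_D(X−a₁)²]`, and the same for `Y`
  have key : ∀ {W : (LandauFree H → E3) → ℝ} {m : ℝ} (mW : Measurable W) (bW : ∀ a ∈ D, |W a| ≤ B) (hm : m = Tilt.tiltExp μD N 0 W) (c : ℝ),
      Tilt.tiltExp μD N 0 (fun a => (W a - m) ^ 2) ≤ 2 * gaussAvg β H (fun a => D.indicator (fun _ => (1 : ℝ)) a * (W a - c) ^ 2) := by
    intro W m mW bW hm c
    have h1 : Tilt.tiltExp μD N 0 (fun a => (W a - m) ^ 2) ≤ Tilt.tiltExp μD N 0 (fun a => (W a - c) ^ 2) := by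
      rw [hm]; exact tiltExp_muSet_zero_centredSq_le hβ hDm hD N hB mW bW c
    have e2 : ∀ a ∈ D, (W a - c) ^ 2 = D.indicator (fun _ => (1 : ℝ)) a * (W a - c) ^ 2 := fun a ha => by
      rw [Set.indicator_of_mem ha, one_mul]
    rw [tiltExp_muSet_congr_on β hDm N 0 e2] at h1
    have h0 : 0 ≤ fun a => D.indicator (fun _ => (1 : ℝ)) a * (W a - c) ^ 2 := fun a =>
      mul_nonneg (indicator_one_nonneg_le_one D a).1 (sq_nonneg _)
    have hWc : ∀ a ∈ D, |(W a - c) ^ 2| ≤ (B + |c|) ^ 2 := fun a ha => by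
      rw [abs_pow]; exact pow_le_pow_left₀ (abs_nonneg _) ((abs_sub _ _).trans (add_le_add (bW a ha) le_rfl)) 2
    have hI := integrable_indicator_mul_of_bdd hβ hDm ((mW.sub measurable_const).pow_const 2) (by positivity) hWc
    exact h1.trans (tiltExp_muSet_zero_le_two_mul_gaussAvg hβ hDm hτ hτ2 N h0 hI)
  have kX := key mX bX hmXc a₁
  have kY := key mY bY hmYc a₂
  -- assemble
  have hX0 : 0 ≤ Tilt.tiltExp μD N 0 (fun a => (X a - mXc) ^ 2) := tiltExp_muSet_zero_nonneg_on hβ hDm hD N fun a _ => sq_nonneg _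
  have hY0 : 0 ≤ Tilt.tiltExp μD N 0 (fun a => (Y a - mYc) ^ 2) := tiltExp_muSet_zero_nonneg_on hβ hDm hD N fun a _ => sq_nonneg _
  have hsq1 : Real.sqrt (Tilt.tiltExp μD N 0 (fun a => (X a - mXc) ^ 2)) ≤
      Real.sqrt (2 * gaussAvg β H (fun a => D.indicator (fun _ => (1 : ℝ)) a * (X a - a₁) ^ 2)) := Real.sqrt_le_sqrt kX
  have hsq2 : Real.sqrt (Tilt.tiltExp μD N 0 (fun a => ((Y a - mYc) * (N a - mNc)) ^ 2)) ≤
      2 * ν * Real.sqrt (2 * gaussAvg β H (fun a => D.indicator (fun _ => (1 : ℝ)) a * (Y a - a₂) ^ 2)) := by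
    calc Real.sqrt (Tilt.tiltExp μD N 0 (fun a => ((Y a - mYc) * (N a - mNc)) ^ 2))
        ≤ Real.sqrt ((2 * ν) ^ 2 * Tilt.tiltExp μD N 0 (fun a => (Y a - mYc) ^ 2)) := Real.sqrt_le_sqrt hmono
      _ = 2 * ν * Real.sqrt (Tilt.tiltExp μD N 0 (fun a => (Y a - mYc) ^ 2)) := by
          rw [Real.sqrt_mul (sq_nonneg _), Real.sqrt_sq h2ν]
      _ ≤ 2 * ν * Real.sqrt (2 * gaussAvg β H (fun a => D.indicator (fun _ => (1 : ℝ)) a * (Y a - a₂) ^ 2)) :=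
          mul_le_mul_of_nonneg_left (Real.sqrt_le_sqrt kY) h2ν
  calc |Tilt.tiltExp μD N 0 (fun a => (X a - mXc) * ((Y a - mYc) * (N a - mNc)))|
      ≤ Real.sqrt (Tilt.tiltExp μD N 0 (fun a => (X a - mXc) ^ 2)) * Real.sqrt (Tilt.tiltExp μD N 0 (fun a => ((Y a - mYc) * (N a - mNc)) ^ 2)) := hCS
    _ ≤ Real.sqrt (2 * gaussAvg β H (fun a => D.indicator (fun _ => (1 : ℝ)) a * (X a - a₁) ^ 2)) *
          (2 * ν * Real.sqrt (2 * gaussAvg β H (fun a => D.indicator (fun _ => (1 : ℝ)) a * (Y a - a₂) ^ 2))) :=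
        mul_le_mul hsq1 hsq2 (Real.sqrt_nonneg _) (Real.sqrt_nonneg _)
    _ = _ := by ring

/-- ★ **The «sup × L²» row at the two linearised plaquette slots**: for `H ≥ 1`, `β > 0`, `D` measurable with `E₀[1 − 1_D] ≤ τ ≤ 1/2`, any measurable `N`
with `|N| ≤ ν` on `D`, and any base points `x y`:
`|κ₃,₀^{μ_D}(linCurvSq(plaq12At x), linCurvSq(plaq12At y); N)| ≤ 4·C_V·ν·(1+log H)²/β²`, `C_V` the constant of ✓`gaussAvg_centred_linCurvSq_sq_le`. -/
theorem abs_tiltCum3_muSet_linCurvSq_linCurvSq_le_of_sup : ∃ C : ℝ, 0 ≤ C ∧ ∀ H : ℕ, 1 ≤ H → ∀ β : ℝ, 0 < β →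
    ∀ s : ℝ, 0 ≤ s → ∀ D : Set (LandauFree H → E3), MeasurableSet D → D ⊆ smallField H s →
    ∀ τ : ℝ, gaussAvg β H (fun a => 1 - D.indicator (fun _ => (1 : ℝ)) a) ≤ τ → τ ≤ 1 / 2 →
    ∀ N : (LandauFree H → E3) → ℝ, Measurable N → ∀ ν : ℝ, 0 ≤ ν → (∀ a ∈ D, |N a| ≤ ν) → ∀ x y : Site 4,
    |Tilt.tiltCum3 ((((volume : Measure (LandauFree H → E3)).restrict D).withDensity fun a => ENNReal.ofReal (gaussWeight β H a))) N 0
        (linCurvSq H (plaq12At x)) (linCurvSq H (plaq12At y))| ≤ C * ν * (1 + Real.log H) ^ 2 / β ^ 2 := by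
  obtain ⟨CV, hCV0, hV⟩ := EdgeChartGaussian.gaussAvg_centred_linCurvSq_sq_le
  refine ⟨4 * CV, by positivity, fun H hH β hβ s hs0 D hDm hDs τ hτ hτ2 N mN ν hν bN x y => ?_⟩
  -- the two plaquette slots are bounded by `16 s²` on `D`
  have bL : ∀ z : Site 4, ∀ a ∈ D, |linCurvSq H (plaq12At z) a| ≤ 16 * s ^ 2 := fun z a ha => by
    rw [abs_of_nonneg (TiltSup.linCurvSq_nonneg' _ a)]; exact TiltSup.linCurvSq_le hs0 (hDs ha) z 1 2
  have h := abs_tiltCum3_muSet_zero_le_sup_mul_sd hβ hDm hτ hτ2 (by positivity) hν (EdgeChartGaussian.measurable_linCurvSq H (plaq12At x))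
    (EdgeChartGaussian.measurable_linCurvSq H (plaq12At y)) mN (bL x) (bL y) bN (gaussAvg β H (linCurvSq H (plaq12At x))) (gaussAvg β H (linCurvSq H (plaq12At y)))
  refine h.trans ?_
  -- `E₀[1_D (L_z − m_z)²] ≤ E₀[(L_z − m_z)²] ≤ C_V L²/β²`
  have hvar : ∀ z : Site 4, gaussAvg β H (fun a => D.indicator (fun _ => (1 : ℝ)) a * (linCurvSq H (plaq12At z) a - gaussAvg β H (linCurvSq H (plaq12At z))) ^ 2) ≤
      CV * (1 + Real.log H) ^ 2 / β ^ 2 := by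
    intro z
    have hc : ∃ Qp : MvPolynomial (LandauFree H × Fin 3) ℝ, Qp.totalDegree ≤ 2 ∧
        ∀ a, linCurvSq H (plaq12At z) a - gaussAvg β H (linCurvSq H (plaq12At z)) = MvPolynomial.eval (LaplaceSandwich.flatten (LandauFree H) a) Qp :=
      EdgeChartGaussian.polyCert_sub (EdgeChartGaussian.polyCert_linCurvSq H _) (EdgeChartGaussian.polyCert_const _ 2)
    have hmono : gaussAvg β H (fun a => D.indicator (fun _ => (1 : ℝ)) a * (linCurvSq H (plaq12At z) a - gaussAvg β H (linCurvSq H (plaq12At z))) ^ 2) ≤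
        gaussAvg β H (fun a => (linCurvSq H (plaq12At z) a - gaussAvg β H (linCurvSq H (plaq12At z))) ^ 2) := by
      refine EdgeChartGaussian.gaussAvg_mono_of_nonneg H hβ (fun a => mul_nonneg (indicator_one_nonneg_le_one D a).1 (sq_nonneg _)) (fun a => ?_)
        (EdgeChartGaussian.integrable_polyCert_mul_gaussWeight H hβ (EdgeChartGaussian.polyCert_pow hc 2))
      calc D.indicator (fun _ => (1 : ℝ)) a * (linCurvSq H (plaq12At z) a - gaussAvg β H (linCurvSq H (plaq12At z))) ^ 2
          ≤ 1 * (linCurvSq H (plaq12At z) a - gaussAvg β H (linCurvSq H (plaq12At z))) ^ 2 :=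
            mul_le_mul_of_nonneg_right (indicator_one_nonneg_le_one D a).2 (sq_nonneg _)
        _ = _ := one_mul _
    exact hmono.trans (hV H hH β hβ (plaq12At z))
  have hL0 : 0 ≤ CV * (1 + Real.log H) ^ 2 / β ^ 2 := by
    have : (1 : ℝ) ≤ H := by exact_mod_cast hH
    have := Real.log_nonneg this
    positivity
  have hsx : Real.sqrt (2 * gaussAvg β H (fun a => D.indicator (fun _ => (1 : ℝ)) a * (linCurvSq H (plaq12At x) a - gaussAvg β H (linCurvSq H (plaq12At x))) ^ 2)) ≤
      Real.sqrt (2 * (CV * (1 + Real.log H) ^ 2 / β ^ 2)) := Real.sqrt_le_sqrt (by linarith [hvar x])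
  have hsy : Real.sqrt (2 * gaussAvg β H (fun a => D.indicator (fun _ => (1 : ℝ)) a * (linCurvSq H (plaq12At y) a - gaussAvg β H (linCurvSq H (plaq12At y))) ^ 2)) ≤
      Real.sqrt (2 * (CV * (1 + Real.log H) ^ 2 / β ^ 2)) := Real.sqrt_le_sqrt (by linarith [hvar y])
  have hprod := mul_le_mul hsx hsy (Real.sqrt_nonneg _) (Real.sqrt_nonneg _)
  rw [← pow_two, Real.sq_sqrt (by positivity)] at hprod
  calc 2 * ν * (Real.sqrt (2 * gaussAvg β H (fun a => D.indicator (fun _ => (1 : ℝ)) a * (linCurvSq H (plaq12At x) a - gaussAvg β H (linCurvSq H (plaq12At x))) ^ 2)) *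
        Real.sqrt (2 * gaussAvg β H (fun a => D.indicator (fun _ => (1 : ℝ)) a * (linCurvSq H (plaq12At y) a - gaussAvg β H (linCurvSq H (plaq12At y))) ^ 2)))
      ≤ 2 * ν * (2 * (CV * (1 + Real.log H) ^ 2 / β ^ 2)) := mul_le_mul_of_nonneg_left hprod (by positivity)
    _ = 4 * CV * ν * (1 + Real.log H) ^ 2 / β ^ 2 := by ring

/-! ## §2 The (γ) row: the sextic Wilson remainder, generic in the quartic form -/

/-- ★★ **Row (γ) of the K3′ table — the sextic Wilson remainder slot, GENERIC in the quartic form `Q`.**  For `H ≥ 1`, `β > 0`, `0 ≤ s ≤ 1`, any family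
`Q p` of measurable plaquette functionals with `|c_p − |ℓ_p|² − c_p^{odd} − Q p| ≤ C_R·s⁶` on `smallField H s` for every plaquette touching the box, every
measurable `D ⊆ smallField H s` with `E₀[1 − 1_D] ≤ τ ≤ 1/2`, and all base points:
`|κ₃,₀^{μ_D}(L_x, L_y; −β·Σ_p (c_p − |ℓ_p|² − c_p^{odd} − Q p))| ≤ 16384·C_V·C_R·H⁴·(1+log H)²·s⁶/β`. -/
theorem abs_tiltCum3_muSet_wilsonSexticRow_le : ∃ C : ℝ, 0 ≤ C ∧ ∀ H : ℕ, 1 ≤ H → ∀ β : ℝ, 0 < β → ∀ s : ℝ, 0 ≤ s → s ≤ 1 →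
    ∀ Q : ZdPlaquette 4 → (LandauFree H → E3) → ℝ, (∀ p, Measurable (Q p)) → ∀ CR : ℝ, 0 ≤ CR →
    (∀ a ∈ smallField H s, ∀ p ∈ plaquettesTouching (boxEdges 4 (2 * H + 1)),
      |chartPlaqCost H p.1 p.2.1.1 p.2.1.2 a - linCurvSq H (p.1, p.2.1.1, p.2.1.2) a - chartPlaqCostOdd H p.1 p.2.1.1 p.2.1.2 a - Q p a| ≤ CR * s ^ 6) →
    ∀ D : Set (LandauFree H → E3), MeasurableSet D → D ⊆ smallField H s →
    ∀ τ : ℝ, gaussAvg β H (fun a => 1 - D.indicator (fun _ => (1 : ℝ)) a) ≤ τ → τ ≤ 1 / 2 → ∀ x y : Site 4,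
    |Tilt.tiltCum3 ((((volume : Measure (LandauFree H → E3)).restrict D).withDensity fun a => ENNReal.ofReal (gaussWeight β H a)))
        (fun a => -(β * ∑ p ∈ plaquettesTouching (boxEdges 4 (2 * H + 1)),
          (chartPlaqCost H p.1 p.2.1.1 p.2.1.2 a - linCurvSq H (p.1, p.2.1.1, p.2.1.2) a - chartPlaqCostOdd H p.1 p.2.1.1 p.2.1.2 a - Q p a))) 0
        (linCurvSq H (plaq12At x)) (linCurvSq H (plaq12At y))| ≤ C * CR * (H : ℝ) ^ 4 * (1 + Real.log H) ^ 2 * s ^ 6 / β := by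
  obtain ⟨C, hC0, hrow⟩ := abs_tiltCum3_muSet_linCurvSq_linCurvSq_le_of_sup
  refine ⟨4096 * C, by positivity, fun H hH β hβ s hs0 hs1 Q mQ CR hCR hRem D hDm hDs τ hτ hτ2 x y => ?_⟩
  set PT := plaquettesTouching (boxEdges 4 (2 * H + 1)) with hPT
  -- measurability of the slot
  have mRem : ∀ p : ZdPlaquette 4, Measurable fun a : LandauFree H → E3 =>
      chartPlaqCost H p.1 p.2.1.1 p.2.1.2 a - linCurvSq H (p.1, p.2.1.1, p.2.1.2) a - chartPlaqCostOdd H p.1 p.2.1.1 p.2.1.2 a - Q p a := fun p =>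
    (((EdgeChartGaussian.measurable_chartPlaqCost H p.1 p.2.1.1 p.2.1.2).sub (EdgeChartGaussian.measurable_linCurvSq H _)).sub
      (EdgeChartGaussian.measurable_chartPlaqCostOdd H p.1 p.2.1.1 p.2.1.2)).sub (mQ p)
  have mN : Measurable fun a : LandauFree H → E3 => -(β * ∑ p ∈ PT,
      (chartPlaqCost H p.1 p.2.1.1 p.2.1.2 a - linCurvSq H (p.1, p.2.1.1, p.2.1.2) a - chartPlaqCostOdd H p.1 p.2.1.1 p.2.1.2 a - Q p a)) :=
    ((Finset.measurable_sum PT fun p _ => mRem p).const_mul β).neg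
  -- the sup of the slot on `D`: `≤ β·#PT·C_R·s⁶ ≤ 4096·C_R·β·H⁴·s⁶`
  have hcard := TiltSup.card_plaquettesTouching_le' (H := H) hH
  have bN : ∀ a ∈ D, |-(β * ∑ p ∈ PT,
      (chartPlaqCost H p.1 p.2.1.1 p.2.1.2 a - linCurvSq H (p.1, p.2.1.1, p.2.1.2) a - chartPlaqCostOdd H p.1 p.2.1.1 p.2.1.2 a - Q p a))| ≤
      4096 * CR * β * (H : ℝ) ^ 4 * s ^ 6 := by
    intro a ha
    rw [abs_neg, abs_mul, abs_of_pos hβ]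
    have hsum := (Finset.abs_sum_le_sum_abs _ _).trans (Finset.sum_le_sum fun p hp => hRem a (hDs ha) p hp)
    rw [Finset.sum_const, nsmul_eq_mul] at hsum
    have hq : 0 ≤ CR * s ^ 6 := by positivity
    calc β * |∑ p ∈ PT, (chartPlaqCost H p.1 p.2.1.1 p.2.1.2 a - linCurvSq H (p.1, p.2.1.1, p.2.1.2) a - chartPlaqCostOdd H p.1 p.2.1.1 p.2.1.2 a - Q p a)|
        ≤ β * (PT.card * (CR * s ^ 6)) := mul_le_mul_of_nonneg_left hsum hβ.le
      _ ≤ β * (4096 * (H : ℝ) ^ 4 * (CR * s ^ 6)) := mul_le_mul_of_nonneg_left (mul_le_mul_of_nonneg_right hcard hq) hβ.le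
      _ = 4096 * CR * β * (H : ℝ) ^ 4 * s ^ 6 := by ring
  have h := hrow H hH β hβ s hs0 D hDm hDs τ hτ hτ2 _ mN _ (by positivity) bN x y
  refine h.trans (le_of_eq ?_)
  field_simp

/-! ## §3 The β-letter budget of row (γ) at the point of record -/

open AssemblyBudget ErrorBudget in
/-- ★ **Budget of row (γ)** at `s = β^{(1/8−θ/4)−1/2}`: for every `0 ≤ θ < 1/10`, any `C`, and every `ε > 0`, eventually on the top slab
`β²·H⁸·(C·H⁴·(1+log H)²·s⁶/β) ≤ ε` — the exponent row (K7) at `κ₃ = 1/8 − θ/4`: `12θ + 1 < 6·(1/2 − κ₃)`, i.e. **`21θ/2 < 5/4 ⟺ θ < 5/42`** (✓ for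
`θ < 1/10`). -/
theorem wilsonSexticRow_budget {θ : ℝ} (hθ : 0 ≤ θ) (hθ' : θ < 1 / 10) (C : ℝ) {ε : ℝ} (hε : 0 < ε) :
    ∃ β₀ : ℝ, 1 ≤ β₀ ∧ ∀ β : ℝ, β₀ ≤ β → ∀ H : ℕ, 1 ≤ H → (H : ℝ) ≤ β ^ θ + 1 →
      β ^ 2 * (H : ℝ) ^ 8 * (C * (H : ℝ) ^ 4 * (1 + Real.log H) ^ 2 * (β ^ ((1 / 8 - θ / 4) - 1 / 2)) ^ 6 / β) ≤ ε := by
  obtain ⟨β₀, hβ₀, h⟩ := budget_monomial (a := 1) (k := 12) (j := 6) (κ₃ := 1 / 8 - θ / 4) hθ (by push_cast; linarith) hε C 2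
  refine ⟨β₀, hβ₀, fun β hβ H hH hHu => ?_⟩
  have hβ0 : 0 < β := by linarith
  have e := h β hβ H hH hHu
  rw [Real.rpow_one] at e
  have hid : β ^ 2 * (H : ℝ) ^ 8 * (C * (H : ℝ) ^ 4 * (1 + Real.log H) ^ 2 * (β ^ ((1 / 8 - θ / 4) - 1 / 2)) ^ 6 / β) =
      C * (H : ℝ) ^ 12 * (1 + Real.log H) ^ 2 * (β ^ ((1 / 8 - θ / 4) - 1 / 2)) ^ 6 * β := by
    field_simp
  rw [hid]
  exact e

end GaussRestrict

end Summit.QuantumFields.YangMills.Theorems.AllWindowsColdBoxBoxHighLine
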